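import Literature.IUT.HodgeTheaters.SplitFrobenioids
import Mathlib.CategoryTheory.Conj
import Mathlib.CategoryTheory.Whiskering
import HarnessLib

/-!
# [IUTchI] Example 3.3 (iii) (e): the criterion for the split clause `SplitFromF` — transport of characteristic
# splittings through the faithful non-full `C⊢_v ⊆ C_v` (merge socket for the (e) assembly)

Mochizuki, *Inter-universal Teichmüller theory I*, kurims manuscript (May 2020), Example 3.3 (iii) (e), p. 79
[claim: Mochizuki2012, status: disputed]: "one may reconstruct the split Frobenioids `F⊢_v`, `F^Θ_v`
category-theoretically from `F̲_v`" (the element `p_v`, hence `τ⊢_v`, via the Kummer map of [AbsTopIII] Prop. 3.2 (iii)) —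
nothing of the series is asserted; no side is taken on [IUTchIII] Cor. 3.12.  Mochizuki, *The geometry of Frobenioids I*,
Def. 2.3 (characteristic splittings are subfunctors in monoids of `𝒪^▷(−)`, compatible with pull-backs)
[cite: MochizukiFrdI2008, Def. 2.3 p.46].

PROOF-ONLY socket (abc-iut cell, seat abc-iut-w4-d047 gen 5; row E33iii/e of `plan/L5/SUBDAG-IUTchI-Ex33-Ex34.md`,
assembly input of L5-lead RULINGS #80's split (E1)/(E2)/(E3)), 0 definitions, no new Prop fact.  abc-iut-L5-t2 typed (e) as
`GoodLocalFrobenioid.SplitFromF`: every self-equivalence `e` of `F̲_v = C_v` lifts along the faithful, non-full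
`C⊢_v ⊆ C_v` to `e'` preserving `τ⊢_v`, and through `F⊢_v ⥲ F^Θ_v` to `e''` preserving `τ^Θ_v`.  Clause (d)
(`CdashFromF`, this lineage + abc-iut-L1-t4 + abc-iut-L5-t16, closed at the printed object) already supplies `e'` with
`C⊢_v ⊆ C_v ⋙ e ≅ e' ⋙ (C⊢_v ⊆ C_v)`.  THIS FILE isolates what (e) adds, as pure category theory:
* `S3Local.CharSplitting.isPreservedBy_of_faithful_lift` — if a splitting `σ` on the ambient `C_v` restricts to `τ⊢` along
  the faithful inclusion `ι` (`τ⊢(A) ↦ σ(ιA)` bijectively), is stable under conjugation by isomorphisms ([FrdI] Def. 2.3),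
  and is PRESERVED BY `e`, then any lift `e'` of `e` along `ι` preserves `τ⊢` (conjugate by the components of the lifting
  isomorphism and cancel the faithful `ι`);
* `S3Local.CharSplitting.isPreservedBy_inverse` / `…_conj_equivalence` — a splitting carried onto an iso-stable splitting by
  an equivalence is carried back by its inverse; hence the `F^Θ_v` half of (e) is automatic from the `F⊢_v` half
  (`GoodLocalFrobenioid.splitFromF_of_dash`);
* `GoodLocalFrobenioid.splitFromF_of_cdashFromF_of_isPreservedBy` — **(e) ⟸ (d) + ONE statement about `C_v` alone**:
  "every self-equivalence of `C_v` preserves the splitting `σ = τ_{p_v}` of `C_v`" (for the [FrdII] models: the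
  endomorphisms with rational function a power of `p_v` are carried to such) — the exact shape delivered by (E1) [FrdI]
  Thm. 3.4 (iv) (`𝒪^▷(−)` is categorical), (E2) [AbsTopIII] Thm. 1.9 / Prop. 3.2 (iii) (geometricity), (E3) classical unit
  rigidity.  At the degenerate instance `ofKitQp` this statement FAILS (this lineage's `not_splitFromF_ofKitQp`), so the
  criterion is sharp there.
Pure category theory over the interface; typed ≠ proved.
-/

namespace Literature.IUT.HodgeTheaters

open CategoryTheory

universe u

namespace S3Local.CharSplitting

variable {T : Type u} [Category.{u} T] {S : Type u} [Category.{u} S]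

/-- The lifting isomorphism computes the lift on endomorphisms: for `η : ι ⋙ e ≅ e' ⋙ ι` and `t ∈ End(A)`,
`ι(e'(t)) = η_A⁻¹ ∘ e(ι(t)) ∘ η_A` (naturality of `η`). [cite: MochizukiFrdI2008, Def. 2.3 p.46] -/
theorem map_lift_eq_conj (ι : T ⥤ S) {e : S ⥤ S} {e' : T ⥤ T} (η : ι ⋙ e ≅ e' ⋙ ι) (A : T) (t : End A) :
    (ι.map (e'.map t) : ι.obj (e'.obj A) ⟶ ι.obj (e'.obj A)) = (η.app A).inv ≫ e.map (ι.map t) ≫ (η.app A).hom := by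
  have h := η.hom.naturality (t : A ⟶ A)
  simp only [Functor.comp_map] at h
  exact ((η.app A).eq_inv_comp).mpr h.symm

/-- **Transport of a characteristic splitting through a faithful (non-full) inclusion.**  Let `ι : T ⥤ S` be faithful,
`τ` a splitting on `T` and `σ` one on `S` with `σ(ιA) = ι(τ(A))` for all `A` (`hL`) and `σ` stable under conjugation by
isomorphisms (`hM`, [FrdI] Def. 2.3).  If a self-equivalence `e` of `S` preserves `σ` and `e'` lifts `e` along `ι`
(`η : ι ⋙ e ≅ e' ⋙ ι`), then `e'` preserves `τ`. [cite: MochizukiFrdI2008, Def. 2.3 p.46] -/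
theorem isPreservedBy_of_faithful_lift (ι : T ⥤ S) [ι.Faithful] (τ : CharSplitting T) (σ : CharSplitting S)
    (hL : ∀ A : T, (τ.sect A).map (ι.mapEnd A) = σ.sect (ι.obj A))
    (hM : ∀ ⦃X Y : S⦄ (i : X ≅ Y), (σ.sect X).map i.conj.toMonoidHom = σ.sect Y)
    {e : S ≌ S} (he : σ.IsPreservedBy σ e.functor) {e' : T ≌ T} (η : ι ⋙ e.functor ≅ e'.functor ⋙ ι) :
    τ.IsPreservedBy τ e'.functor := by
  intro A
  -- the component of the lifting isomorphism at `A`, with clean source and target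
  let i : e.functor.obj (ι.obj A) ≅ ι.obj (e'.functor.obj A) := η.app A
  -- it suffices to compare the images under the injective `ι.mapEnd (e' A)`
  have hinj : Function.Injective (ι.mapEnd (e'.functor.obj A)) := fun a b h => ι.map_injective h
  have hcomp : (ι.mapEnd (e'.functor.obj A)).comp (e'.functor.mapEnd A) =
      (i.conj.toMonoidHom.comp (e.functor.mapEnd (ι.obj A))).comp (ι.mapEnd A) :=
    MonoidHom.ext fun t => by
      change ι.map (e'.functor.map t) = i.conj (e.functor.map (ι.map t))
      rw [Iso.conj_apply]
      exact map_lift_eq_conj ι η A t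
  have key : ((τ.sect A).map (e'.functor.mapEnd A)).map (ι.mapEnd (e'.functor.obj A)) =
      (τ.sect (e'.functor.obj A)).map (ι.mapEnd (e'.functor.obj A)) := by
    rw [Submonoid.map_map, hcomp, ← Submonoid.map_map, ← Submonoid.map_map, hL A, he (ι.obj A), hM i,
      hL (e'.functor.obj A)]
  have h := congrArg (Submonoid.comap (ι.mapEnd (e'.functor.obj A))) key
  rwa [Submonoid.comap_map_eq_of_injective hinj, Submonoid.comap_map_eq_of_injective hinj] at h

/-- An equivalence `Φ` carrying `τ` onto an iso-stable splitting `τ'` is undone by its inverse: `Φ⁻¹` carries `τ'` onto `τ`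
(conjugate by the counit and cancel the faithful `Φ`). [cite: MochizukiFrdI2008, Def. 2.3 p.46] -/
theorem isPreservedBy_inverse {C : Type u} [Category.{u} C] {C' : Type u} [Category.{u} C'] (τ : CharSplitting C)
    (τ' : CharSplitting C') (Φ : C ≌ C') (hΦ : τ.IsPreservedBy τ' Φ.functor)
    (hM' : ∀ ⦃X Y : C'⦄ (i : X ≅ Y), (τ'.sect X).map i.conj.toMonoidHom = τ'.sect Y) :
    τ'.IsPreservedBy τ Φ.inverse := by
  intro B
  -- the counit at `B`, with clean source and target
  let c : Φ.functor.obj (Φ.inverse.obj B) ≅ B := Φ.counitIso.app B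
  have hinj : Function.Injective (Φ.functor.mapEnd (Φ.inverse.obj B)) := fun a b h => Φ.functor.map_injective h
  -- `Φ(Φ⁻¹(t)) = c ∘ t ∘ c⁻¹`
  have hcomp : (Φ.functor.mapEnd (Φ.inverse.obj B)).comp (Φ.inverse.mapEnd B) = c.symm.conj.toMonoidHom := by
    refine MonoidHom.ext fun t => ?_
    change Φ.functor.map (Φ.inverse.map t) = c.symm.conj t
    rw [Iso.conj_apply, Iso.symm_inv, Iso.symm_hom]
    have h := Φ.counitIso.hom.naturality (t : B ⟶ B)
    simp only [Functor.comp_map, Functor.id_map] at h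
    rw [← Category.assoc]
    exact (c.eq_comp_inv).mpr h
  have key : ((τ'.sect B).map (Φ.inverse.mapEnd B)).map (Φ.functor.mapEnd (Φ.inverse.obj B)) =
      (τ.sect (Φ.inverse.obj B)).map (Φ.functor.mapEnd (Φ.inverse.obj B)) := by
    rw [Submonoid.map_map, hcomp, hM' c.symm, hΦ (Φ.inverse.obj B)]
  have h := congrArg (Submonoid.comap (Φ.functor.mapEnd (Φ.inverse.obj B))) key
  rwa [Submonoid.comap_map_eq_of_injective hinj, Submonoid.comap_map_eq_of_injective hinj] at h

/-- Composition: if `Φ` carries `τ₁` onto `τ₂` and `Ψ` carries `τ₂` onto `τ₃`, then `Φ ⋙ Ψ` carries `τ₁` onto `τ₃`.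
[cite: MochizukiFrdI2008, Def. 2.3 p.46] -/
theorem isPreservedBy_comp {C₁ : Type u} [Category.{u} C₁] {C₂ : Type u} [Category.{u} C₂] {C₃ : Type u}
    [Category.{u} C₃] (τ₁ : CharSplitting C₁) (τ₂ : CharSplitting C₂) (τ₃ : CharSplitting C₃) (Φ : C₁ ⥤ C₂)
    (Ψ : C₂ ⥤ C₃) (hΦ : τ₁.IsPreservedBy τ₂ Φ) (hΨ : τ₂.IsPreservedBy τ₃ Ψ) : τ₁.IsPreservedBy τ₃ (Φ ⋙ Ψ) := by
  intro A
  change (τ₁.sect A).map ((Ψ.mapEnd (Φ.obj A)).comp (Φ.mapEnd A)) = τ₃.sect (Ψ.obj (Φ.obj A))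
  rw [← Submonoid.map_map, hΦ A, hΨ (Φ.obj A)]

/-- **Conjugating a `τ`-preserving self-equivalence through a split equivalence.**  If `Φ : C ≌ C'` carries `τ` onto the
iso-stable `τ'` and `e'` preserves `τ`, then `Φ⁻¹ ⋙ e' ⋙ Φ` preserves `τ'` (the `F^Θ_v` half of [IUTchI] Ex. 3.3 (iii)
(e) from the `F⊢_v` half, through `F⊢_v ⥲ F^Θ_v`). [cite: MochizukiFrdI2008, Def. 2.3 p.46] -/
theorem isPreservedBy_conj_equivalence {C : Type u} [Category.{u} C] {C' : Type u} [Category.{u} C']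
    (τ : CharSplitting C) (τ' : CharSplitting C') (Φ : C ≌ C') (hΦ : τ.IsPreservedBy τ' Φ.functor)
    (hM' : ∀ ⦃X Y : C'⦄ (i : X ≅ Y), (τ'.sect X).map i.conj.toMonoidHom = τ'.sect Y) {e' : C ≌ C}
    (he' : τ.IsPreservedBy τ e'.functor) :
    τ'.IsPreservedBy τ' ((Φ.symm.trans e').trans Φ).functor :=
  isPreservedBy_comp τ' τ τ' (Φ.inverse ⋙ e'.functor) Φ.functor
    (isPreservedBy_comp τ' τ τ Φ.inverse e'.functor (isPreservedBy_inverse τ τ' Φ hΦ hM') he') hΦ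

end S3Local.CharSplitting

/-! ### The criterion for `SplitFromF` -/

namespace GoodLocalFrobenioid

variable {p : ℕ} {Kv : Type} [Field Kv] [ValuativeRel Kv] (G : GoodLocalFrobenioid.{u} p Kv)

/-- **The `F^Θ_v` half of (e) is automatic**: if every self-equivalence of `F̲_v = C_v` lifts along `C⊢_v ⊆ C_v` to a
`τ⊢_v`-preserving self-equivalence of `C⊢_v`, and `τ^Θ_v` is stable under conjugation by isomorphisms ([FrdI] Def. 2.3),
then `SplitFromF` holds — conjugate the lift through the split equivalence `F⊢_v ⥲ F^Θ_v` of Ex. 3.3 (ii).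
([IUTchI] Ex 3.3 (iii) (e) p.79) [claim: Mochizuki2012, status: disputed] -/
theorem splitFromF_of_dash
    (hΘ : ∀ ⦃X Y : G.CTheta⦄ (i : X ≅ Y), (G.tauTheta.sect X).map i.conj.toMonoidHom = G.tauTheta.sect Y)
    (h : ∀ e : G.Cv ≌ G.Cv, ∃ e' : G.Cdash ≌ G.Cdash,
      Nonempty (G.CdashToC ⋙ e.functor ≅ e'.functor ⋙ G.CdashToC) ∧ G.tauDash.IsPreservedBy G.tauDash e'.functor) :
    G.SplitFromF := by
  intro e
  obtain ⟨e', hη, he'⟩ := h e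
  refine ⟨e', (G.dashThetaEquiv.symm.trans e').trans G.dashThetaEquiv, hη, he', ⟨?_⟩,
    S3Local.CharSplitting.isPreservedBy_conj_equivalence _ _ G.dashThetaEquiv G.dashThetaEquiv_tau hΘ he'⟩
  -- `Φ ⋙ (Φ⁻¹ ⋙ e' ⋙ Φ) ≅ e' ⋙ Φ` by the unit of `Φ = dashThetaEquiv`
  change G.dashThetaEquiv.functor ⋙ (G.dashThetaEquiv.inverse ⋙ e'.functor) ⋙ G.dashThetaEquiv.functor ≅
    e'.functor ⋙ G.dashThetaEquiv.functor
  exact (Functor.associator _ _ _).symm ≪≫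
    Functor.isoWhiskerRight ((Functor.associator _ _ _).symm ≪≫
      Functor.isoWhiskerRight G.dashThetaEquiv.unitIso.symm e'.functor ≪≫
      e'.functor.leftUnitor) G.dashThetaEquiv.functor

/-- **[IUTchI] Ex. 3.3 (iii) (e) ⟸ (d) + "self-equivalences of `C_v` preserve `τ_{p_v}` on `C_v`".**  Let `σ` be a
splitting on `F̲_v = C_v` restricting to `τ⊢_v` along `C⊢_v ⊆ C_v` (`hL`) and stable under conjugation by
isomorphisms (`hM`), with `τ^Θ_v` likewise stable (`hΘ`).  If clause (d) holds (`CdashFromF`: every self-equivalence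
lifts along `C⊢_v ⊆ C_v`) and every self-equivalence of `C_v` preserves `σ` (`hfix` — the content of the Kummer-theoretic
reconstruction of `p_v`, [AbsTopIII] Prop. 3.2 (iii); FALSE at the degenerate `ofKitQp`), then clause (e) holds.
([IUTchI] Ex 3.3 (iii) (e) p.79) [claim: Mochizuki2012, status: disputed] -/
theorem splitFromF_of_cdashFromF_of_isPreservedBy (σ : S3Local.CharSplitting G.Cv)
    (hL : ∀ A : G.Cdash, (G.tauDash.sect A).map (G.CdashToC.mapEnd A) = σ.sect (G.CdashToC.obj A))
    (hM : ∀ ⦃X Y : G.Cv⦄ (i : X ≅ Y), (σ.sect X).map i.conj.toMonoidHom = σ.sect Y)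
    (hΘ : ∀ ⦃X Y : G.CTheta⦄ (i : X ≅ Y), (G.tauTheta.sect X).map i.conj.toMonoidHom = G.tauTheta.sect Y)
    (hd : G.CdashFromF) (hfix : ∀ e : G.Cv ≌ G.Cv, σ.IsPreservedBy σ e.functor) : G.SplitFromF := by
  refine G.splitFromF_of_dash hΘ fun e => ?_
  obtain ⟨e', ⟨η⟩⟩ := hd e
  exact ⟨e', ⟨η⟩, S3Local.CharSplitting.isPreservedBy_of_faithful_lift G.CdashToC G.tauDash σ hL hM (hfix e) η⟩

/-- Conversely, the `F⊢_v` half of (e) alone: `SplitFromF` gives, for every self-equivalence of `C_v`, a lift preserving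
`τ⊢_v` (projection of the typed clause; recorded for consumers that only need `F⊢_v`).
([IUTchI] Ex 3.3 (iii) (e) p.79) [claim: Mochizuki2012, status: disputed] -/
theorem exists_lift_isPreservedBy_of_splitFromF (h : G.SplitFromF) (e : G.Cv ≌ G.Cv) :
    ∃ e' : G.Cdash ≌ G.Cdash,
      Nonempty (G.CdashToC ⋙ e.functor ≅ e'.functor ⋙ G.CdashToC) ∧ G.tauDash.IsPreservedBy G.tauDash e'.functor := by
  obtain ⟨e', -, hη, hτ, -, -⟩ := h e
  exact ⟨e', hη, hτ⟩

end GoodLocalFrobenioid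

end Literature.IUT.HodgeTheaters
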